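/-
Copyright: the b2b-balaban T⁴-continuum CRUX team, row NE7b OWNER lineage `t4-ne7b-p1` (gen 142). Project licence.
-/
import Summits.QuantumFields.BalabanUV.T4Continuum.Spine.NE7b.SupFourthKernelEntryLettersOne

/-!
# THE FOUR FIXED-SLOT LETTERS OF THE ORDER-FOUR ENTRY MAJORANT, SLOTS THREE AND FOUR (the order-4 block of the kernel-letter CLASS MAP; finite sums).  (526)'s
# background-free majorant of `|∂⁴W[e_y,e_z,e_t,e_x]|` has the abstract shape
#   `M_{xyzt} = K4_{yztx} + E(k^{xzt},b^y) + E(k^{xyt},b^z) + E(k^{xyz},b^t) + E(b^x,k^{yzt}) + E(g^{xy},g^{zt}) + E(g^{xz},g^{yt}) + E(g^{xt},g^{yz})`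
#   `          + Σ₆ 𝟙[Hk ≠ 0]·C₃∕(ρρ) + C₄·Σ_TΠ_{e∈T}r_e⁻²`,   `E(a,b) = Σ_w(Dᵀa)_w(Dᵀb)_w∕c`
# (`k^{abc}_w = Σ_u|A_{uw}|K4_{abcu}`, `b^v_w = Σ_u|A_{uw}|Hk_{vu}`, `g^{ab}_w = Σ_u|A_{uw}|K3_{abu}`; `D ≥ 0` with plain letters `dr, dc`; `C₃, C₄ ≥ 0`
# letters).  FORMAT AUDIT: the input letter `|U⁗φ[e_u,e_x,e_y,e_z]| ≤ K4_{xyzu}` makes `K4⁺_{yztx} := M_{xyzt}` the output's majorant, so to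
# ITERATE one needs `M`'s triple sums with EACH slot fixed, closing on FOUR input letters of `K4` (`k4r`: slot 1 fixed; `k4s2`; `k4s3`; `k4c`:
# slot 4), the three of `K3` (`k3r, k3m, k3c`), `hr, hc`, the factor's `αr, αc`, `dr, dc, c`, the site letters `S` (`ρ`, symmetric) and `S′`
# (`r`, symmetric), and the support counts of `Hk` in BOTH indices (`n`):
#   slot 3 (`z` fixed): `Σ_{x,y,t}M ≤ k4s2 + (2αr·k4s2·αc·hc + hr·αr·αc·k4c + αr·k4s3·αc·hc + αr·k3r·αc·k3c + 2αr·k3m·αc·k3c)·dr·dc∕c`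
#                       `+ 6n·C₃S² + 16C₄S′³`,
#   slot 4 (`t` fixed): `Σ_{x,y,z}M ≤ k4s3 + (3αr·k4s3·αc·hc + hr·αr·αc·k4c + 3αr·k3m·αc·k3c)·dr·dc∕c + 6n·C₃S² + 16C₄S′³`
# — NO symmetry of `∂⁴W`, `K4` or `K3` is used (row NE7b, node U5c; (527) and its imports BY NAME; [folklore] finite sums)

Cell `pub-balaban`, sub-cell `t4`, spine estimate NE7b (`T4WeightBudget.RelWeightBound`; the cell's OWN estimate — NOT PRINTED in
[Bałaban 1983–89], NOT PROVED).  Crux-route work under `Spine/NE7b/` by the row OWNER (`t4-ne7b-p1` gen 142, file (529)) under FREEZE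
(0)'s crux-prover clause; NOTHING of Bałaban's is named as a Lean object, valued or asserted; no `T4Continuum/Support` leaf typed; no
`def`, no notation (`M` WRITTEN OUT); zero `sorry`.  Imports (BY NAME): the OWNER's (527) `…SupFourthKernelSlotSums` (masters, masses, supported
star∕path sums, tree slot sums, reindexings; (512), (510), (488), (482), (456), (522) through it).

WHAT IS PROVED ([folklore]): §1 is (528)'s (imported); §2 THE ENDS (SLOTS THREE AND FOUR); §3 toy.

HONEST (what this is NOT).  Finite sums over an abstract majorant shape; the instantiation with (526)'s constants and the packaged order-4
class block (entry format, four letters, operator letter by Schur) are the next files; scalar skeleton ((A3), NC-NE7b-α UNRULED); nothing of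
Bałaban's asserted.  BY-NAME EFFECT ON THE WALL: NONE.  NE7b NOT PRINTED ∕ NOT PROVED; spine PROVED 0∕9; rung (B)+1 — the programme's measures
remain FINITE-torus statements; NOT the mass gap, NOT Clay.  HONEST DEPENDENCY: continuum YM on T⁴ ⇐ BetaPertH ∧ nine spine estimates (0∕9
proved); BetaPertH ⇐ (D1) ∧ (D4) ∧ CAP+tail; G-an2-4 gates asym, D1 and NE2∕3∕4.
-/

set_option autoImplicit false
set_option maxSynthPendingDepth 3

noncomputable section

namespace Summit.QuantumFields.BalabanUV.T4Continuum.NE7b.SupFourthKernelEntryLettersTwo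

open Finset Real
open scoped BigOperators
open SupThirdKernelEntryLetters (two_point_symm two_point_family_sum_le)
open SupFourthKernelTwoPointLetters (third_vector_nonneg third_vector_mass_le third_vector_colsum_le)
open SupWhitenedHessianGradientCovariance (hessian_obs_mass_le)
open SupKernelClassThirdLetters (hessian_obs_mass_second hessian_obs_colsum)
open SupWhitenedFirstOrderLetters (whitened_obs_rowsum_le whitened_obs_colsum_le whitened_obs_nonneg)
open SupHessianVectorGeometryLetters (hess_vector_nonneg)
open SupFourPointTreeRowSum (tree_sum_row_le)
open SupWhitenedFourthKernelPieces (sum3_swap12 sum3_swap23 sum3_cycle sum3_cycle')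
open SupFourthKernelEntryLettersOne (master_single' master_single_rev' const_mul_sum3_le sum3_add15 master21 master12 master21_rev master12_rev
  master03_rev master03)
open SupFourthKernelSlotSums (master_two_point master_two_point_rev third_vector_mass_two third_vector_mass_three star_root_x star_root_i
  star_root_j star_root_k path_root_x path_root_a path_root_b path_root_c tree16_sum_slot_two tree16_sum_slot_three tree16_sum_slot_four sum3_swap13)

variable {ι κ : Type} [Fintype ι] [DecidableEq ι] [Fintype κ] [DecidableEq κ]

/-! ## §1. (the generic lemmas are (528)'s §1, imported) -/

/-! ## §2. THE ENDS -/

section TheEnds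

variable {Hk : ι → ι → ℝ} {K3 : ι → ι → ι → ℝ} {K4 : ι → ι → ι → ι → ℝ} {A : Matrix ι κ ℝ} {D : κ → κ → ℝ}
  {αr αc hr hc k3r k3c k3m k4r k4c k4s2 k4s3 dr dc c C₃ C₄ S S' : ℝ} {ρ r : ι → ι → ℝ} {n : ℕ}

omit [DecidableEq ι] [DecidableEq κ] in
/-- **SLOT 3 (`z` fixed; the output's `k4s2⁺`)**. [folklore] -/
theorem entry_majorant4_slot_three [Nonempty κ] (hK40 : ∀ x y z u, 0 ≤ K4 x y z u) (hK30 : ∀ x y u, 0 ≤ K3 x y u) (hHk0 : ∀ v u, 0 ≤ Hk v u)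
    (hαr : ∀ u, ∑ w, |A u w| ≤ αr) (hαc : ∀ w, ∑ u, |A u w| ≤ αc) (hhr : ∀ v, ∑ u, Hk v u ≤ hr) (hhc : ∀ u, ∑ v, Hk v u ≤ hc) (hk3r : ∀ x, ∑ y, ∑ u,
        K3 x y u ≤ k3r) (hk3c : ∀ u, ∑ y, ∑ z, K3 y z u ≤ k3c) (hk3m : ∀ y, ∑ x, ∑ u, K3 x y u ≤ k3m) (hk4c : ∀ u, ∑ y, ∑ z, ∑ t, K4 y z t u ≤ k4c)
        (hk4s2 : ∀ y, ∑ x, ∑ t, ∑ u, K4 x y t u ≤ k4s2) (hk4s3 : ∀ z, ∑ x, ∑ y, ∑ u, K4 x y z u ≤ k4s3) (hρsymm : ∀ x y, ρ x y = ρ y x) (hn : ∀ b,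
        (Finset.univ.filter (fun a => Hk a b ≠ 0)).card ≤ n) (hn' : ∀ a, (Finset.univ.filter (fun b => Hk a b ≠ 0)).card ≤ n) (hrsymm : ∀ x y, r x y
        = r y x) (hSr : ∀ u, ∑ v, (r u v ^ 2)⁻¹ ≤ S')
    (hD : ∀ x y, 0 ≤ D x y) (hDr : ∀ z, ∑ w, D z w ≤ dr) (hDc : ∀ w, ∑ z, D z w ≤ dc) (hcpos : 0 < c) (hC3 : 0 ≤ C₃) (hC4 : 0 ≤ C₄)
    (hρ1 : ∀ x y, 1 ≤ ρ x y) (hS : ∀ x, ∑ y, 1 / ρ x y ≤ S) (z : ι) :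
    ∑ x, ∑ y, ∑ t, (K4 y z t x + ∑ w, (∑ z', D z' w * ∑ u, |A u z'| * K4 x z t u) * (∑ z', D z' w * ∑ u, |A u z'| * Hk y u) / c + ∑ w, (∑ z', D z' w
        * ∑ u, |A u z'| * K4 x y t u) * (∑ z', D z' w * ∑ u, |A u z'| * Hk z u) / c +
        ∑ w, (∑ z', D z' w * ∑ u, |A u z'| * K4 x y z u) * (∑ z', D z' w * ∑ u, |A u z'| * Hk t u) / c + ∑ w, (∑ z', D z' w * ∑ u, |A u z'| * Hk x u)
            * (∑ z', D z' w * ∑ u, |A u z'| * K4 y z t u) / c +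
        ∑ w, (∑ z', D z' w * ∑ u, |A u z'| * K3 x y u) * (∑ z', D z' w * ∑ u, |A u z'| * K3 z t u) / c + ∑ w, (∑ z', D z' w * ∑ u, |A u z'| * K3 x z
            u) * (∑ z', D z' w * ∑ u, |A u z'| * K3 y t u) / c +
        ∑ w, (∑ z', D z' w * ∑ u, |A u z'| * K3 x t u) * (∑ z', D z' w * ∑ u, |A u z'| * K3 y z u) / c +
        (if Hk y x = 0 then (0 : ℝ) else C₃ / (ρ x z * ρ x t)) + (if Hk z x = 0 then (0 : ℝ) else C₃ / (ρ x y * ρ x t)) +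
        (if Hk t x = 0 then (0 : ℝ) else C₃ / (ρ x y * ρ x z)) + (if Hk z y = 0 then (0 : ℝ) else C₃ / (ρ x y * ρ x t)) +
        (if Hk t y = 0 then (0 : ℝ) else C₃ / (ρ x y * ρ x z)) + (if Hk t z = 0 then (0 : ℝ) else C₃ / (ρ x z * ρ x y)) +
        C₄ *
       ((r x y ^ 2)⁻¹ * (r x z ^ 2)⁻¹ * (r x t ^ 2)⁻¹ + (r x y ^ 2)⁻¹ * (r y z ^ 2)⁻¹ * (r y t ^ 2)⁻¹ + (r x z ^ 2)⁻¹ * (r y z ^ 2)⁻¹ * (r z t ^ 2)⁻¹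
           + (r x t ^ 2)⁻¹ * (r y t ^ 2)⁻¹ * (r z t ^ 2)⁻¹ + (r x y ^ 2)⁻¹ * (r y z ^ 2)⁻¹ * (r z t ^ 2)⁻¹ + (r x y ^ 2)⁻¹ * (r y t ^ 2)⁻¹ * (r z t ^
           2)⁻¹ + (r x z ^ 2)⁻¹ * (r y z ^ 2)⁻¹ * (r y t ^ 2)⁻¹ + (r x z ^ 2)⁻¹ * (r y t ^ 2)⁻¹ * (r z t ^ 2)⁻¹ + (r x t ^ 2)⁻¹ * (r y z ^ 2)⁻¹ * (r
           y t ^ 2)⁻¹ + (r x t ^ 2)⁻¹ * (r y z ^ 2)⁻¹ * (r z t ^ 2)⁻¹ + (r x y ^ 2)⁻¹ * (r x z ^ 2)⁻¹ * (r z t ^ 2)⁻¹ + (r x y ^ 2)⁻¹ * (r x t ^ 2)⁻¹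
           * (r z t ^ 2)⁻¹ + (r x y ^ 2)⁻¹ * (r x z ^ 2)⁻¹ * (r y t ^ 2)⁻¹ + (r x z ^ 2)⁻¹ * (r x t ^ 2)⁻¹ * (r y t ^ 2)⁻¹ + (r x y ^ 2)⁻¹ * (r x t ^
           2)⁻¹ * (r y z ^ 2)⁻¹ + (r x z ^ 2)⁻¹ * (r x t ^ 2)⁻¹ * (r y z ^ 2)⁻¹)) ≤
      k4s2 + (2 * (αr * k4s2 * (αc * hc)) + hr * αr * (αc * k4c) + αr * k4s3 * (αc * hc) + αr * k3r * (αc * k3c) + 2 * (αr * k3m * (αc * k3c))) *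
        dr * dc / c + 6 * ((n : ℝ) * (C₃ * S ^ 2)) + C₄ * (16 * S' ^ 3) := by
  haveI : Nonempty ι := ⟨z⟩
  obtain ⟨w₀⟩ := ‹Nonempty κ›
  have hbv0 : 0 ≤ αc * hc := (Finset.sum_nonneg fun v _ => whitened_obs_nonneg hHk0 A v w₀).trans (whitened_obs_colsum_le hHk0 hαc hhc w₀)
  have hkv0 : 0 ≤ αc * k4c := (Finset.sum_nonneg fun y _ => Finset.sum_nonneg fun z _ => Finset.sum_nonneg fun t _ =>
    third_vector_nonneg hK40 A y z t w₀).trans (third_vector_colsum_le hK40 hαc hk4c w₀)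
  have hgv0 : 0 ≤ αc * k3c := (Finset.sum_nonneg fun y _ => Finset.sum_nonneg fun z _ => hess_vector_nonneg hK30 A y z w₀).trans
    (hessian_obs_colsum hK30 hαc hk3c w₀)
  have h1 := (sum3_cycle' _).symm.trans_le (hk4s2 z)
  have h2 := master21 hD hDr hDc hcpos (a := (fun x t w => ∑ u, |A u w| * K4 x z t u)) (b := (fun y w => ∑ u, |A u w| * Hk y u)) (fun _ _ z =>
      third_vector_nonneg hK40 A _ _ _ z) (fun _ z => whitened_obs_nonneg hHk0 A _ z) (third_vector_mass_two hK40 hαr hk4s2 z) (fun w =>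
      whitened_obs_colsum_le hHk0 hαc hhc w) hbv0
  beta_reduce at h2
  replace h2 := (sum3_swap23 _).symm.trans_le h2
  have h3 := master03_rev hD hDr hDc hcpos (a := (fun w => ∑ u, |A u w| * Hk z u)) (b := (fun x y t w => ∑ u, |A u w| * K4 x y t u)) (fun z =>
      whitened_obs_nonneg hHk0 A _ z) (fun _ _ _ z => third_vector_nonneg hK40 A _ _ _ z) (whitened_obs_rowsum_le hHk0 hαr hhr z) (fun w =>
      third_vector_colsum_le hK40 hαc hk4c w) hkv0
  beta_reduce at h3
  have h4 := master21 hD hDr hDc hcpos (a := (fun x y w => ∑ u, |A u w| * K4 x y z u)) (b := (fun t w => ∑ u, |A u w| * Hk t u)) (fun _ _ z =>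
      third_vector_nonneg hK40 A _ _ _ z) (fun _ z => whitened_obs_nonneg hHk0 A _ z) (third_vector_mass_three hK40 hαr hk4s3 z) (fun w =>
      whitened_obs_colsum_le hHk0 hαc hhc w) hbv0
  beta_reduce at h4
  have h5 := master21_rev hD hDr hDc hcpos (a := (fun y t w => ∑ u, |A u w| * K4 y z t u)) (b := (fun x w => ∑ u, |A u w| * Hk x u)) (fun _ _ z =>
      third_vector_nonneg hK40 A _ _ _ z) (fun _ z => whitened_obs_nonneg hHk0 A _ z) (third_vector_mass_two hK40 hαr hk4s2 z) (fun w =>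
      whitened_obs_colsum_le hHk0 hαc hhc w) hbv0
  beta_reduce at h5
  have h6 := master12_rev hD hDr hDc hcpos (a := (fun t w => ∑ u, |A u w| * K3 z t u)) (b := (fun x y w => ∑ u, |A u w| * K3 x y u)) (fun _ z =>
      hess_vector_nonneg hK30 A _ _ z) (fun _ _ z => hess_vector_nonneg hK30 A _ _ z) (hessian_obs_mass_le hK30 hαr hk3r z) (fun w =>
      hessian_obs_colsum hK30 hαc hk3c w) hgv0
  beta_reduce at h6
  have h7 := master12 hD hDr hDc hcpos (a := (fun x w => ∑ u, |A u w| * K3 x z u)) (b := (fun y t w => ∑ u, |A u w| * K3 y t u)) (fun _ z =>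
      hess_vector_nonneg hK30 A _ _ z) (fun _ _ z => hess_vector_nonneg hK30 A _ _ z) (hessian_obs_mass_second hK30 hαr hk3m z) (fun w =>
      hessian_obs_colsum hK30 hαc hk3c w) hgv0
  beta_reduce at h7
  have h8 := master12_rev hD hDr hDc hcpos (a := (fun y w => ∑ u, |A u w| * K3 y z u)) (b := (fun x t w => ∑ u, |A u w| * K3 x t u)) (fun _ z =>
      hess_vector_nonneg hK30 A _ _ z) (fun _ _ z => hess_vector_nonneg hK30 A _ _ z) (hessian_obs_mass_second hK30 hαr hk3m z) (fun w =>
      hessian_obs_colsum hK30 hαc hk3c w) hgv0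
  beta_reduce at h8
  replace h8 := (sum3_swap23 _).symm.trans_le h8
  have h9 := star_root_j hC3 hρ1 hρsymm hS hn z
  have h10 := star_root_i hC3 hρ1 hS hn' z
  have h11 := (sum3_swap23 _).symm.trans_le (star_root_k hC3 hρ1 hρsymm hS hn z)
  have h12 := (sum3_swap12 _).symm.trans_le (path_root_a hC3 hρ1 hρsymm hS hn' z)
  have h13 := path_root_c hC3 hρ1 hρsymm hS hn z
  have h14 := (sum3_cycle _).symm.trans_le (path_root_b hC3 hρ1 hρsymm hS hn z)
  have h15 := const_mul_sum3_le hC4 (tree16_sum_slot_three hrsymm hSr z)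
  beta_reduce at h1 h2 h3 h4 h5 h6 h7 h8 h9 h10 h11 h12 h13 h14
  have hsum := add_le_add (add_le_add (add_le_add (add_le_add (add_le_add (add_le_add (add_le_add (add_le_add (add_le_add (add_le_add (add_le_add
    (add_le_add (add_le_add (add_le_add h1 h2) h3) h4) h5) h6) h7) h8) h9) h10) h11) h12) h13) h14) h15
  exact (sum3_add15 _ _ _ _ _ _ _ _ _ _ _ _ _ _ _).trans_le (hsum.trans (le_of_eq (by ring)))

omit [DecidableEq ι] [DecidableEq κ] in
/-- **SLOT 4 (`t` fixed; the output's `k4s3⁺`)**. [folklore] -/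
theorem entry_majorant4_slot_four [Nonempty κ] (hK40 : ∀ x y z u, 0 ≤ K4 x y z u) (hK30 : ∀ x y u, 0 ≤ K3 x y u) (hHk0 : ∀ v u, 0 ≤ Hk v u)
    (hαr : ∀ u, ∑ w, |A u w| ≤ αr) (hαc : ∀ w, ∑ u, |A u w| ≤ αc) (hhr : ∀ v, ∑ u, Hk v u ≤ hr) (hhc : ∀ u, ∑ v, Hk v u ≤ hc) (hk3c : ∀ u, ∑ y, ∑ z,
        K3 y z u ≤ k3c) (hk3m : ∀ y, ∑ x, ∑ u, K3 x y u ≤ k3m) (hk4c : ∀ u, ∑ y, ∑ z, ∑ t, K4 y z t u ≤ k4c) (hk4s3 : ∀ z, ∑ x, ∑ y, ∑ u, K4 x y z u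
        ≤ k4s3) (hρsymm : ∀ x y, ρ x y = ρ y x) (hn : ∀ b, (Finset.univ.filter (fun a => Hk a b ≠ 0)).card ≤ n) (hn' : ∀ a, (Finset.univ.filter (fun
        b => Hk a b ≠ 0)).card ≤ n) (hrsymm : ∀ x y, r x y = r y x) (hSr : ∀ u, ∑ v, (r u v ^ 2)⁻¹ ≤ S')
    (hD : ∀ x y, 0 ≤ D x y) (hDr : ∀ z, ∑ w, D z w ≤ dr) (hDc : ∀ w, ∑ z, D z w ≤ dc) (hcpos : 0 < c) (hC3 : 0 ≤ C₃) (hC4 : 0 ≤ C₄)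
    (hρ1 : ∀ x y, 1 ≤ ρ x y) (hS : ∀ x, ∑ y, 1 / ρ x y ≤ S) (t : ι) :
    ∑ x, ∑ y, ∑ z, (K4 y z t x + ∑ w, (∑ z', D z' w * ∑ u, |A u z'| * K4 x z t u) * (∑ z', D z' w * ∑ u, |A u z'| * Hk y u) / c + ∑ w, (∑ z', D z' w
        * ∑ u, |A u z'| * K4 x y t u) * (∑ z', D z' w * ∑ u, |A u z'| * Hk z u) / c +
        ∑ w, (∑ z', D z' w * ∑ u, |A u z'| * K4 x y z u) * (∑ z', D z' w * ∑ u, |A u z'| * Hk t u) / c + ∑ w, (∑ z', D z' w * ∑ u, |A u z'| * Hk x u)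
            * (∑ z', D z' w * ∑ u, |A u z'| * K4 y z t u) / c +
        ∑ w, (∑ z', D z' w * ∑ u, |A u z'| * K3 x y u) * (∑ z', D z' w * ∑ u, |A u z'| * K3 z t u) / c + ∑ w, (∑ z', D z' w * ∑ u, |A u z'| * K3 x z
            u) * (∑ z', D z' w * ∑ u, |A u z'| * K3 y t u) / c +
        ∑ w, (∑ z', D z' w * ∑ u, |A u z'| * K3 x t u) * (∑ z', D z' w * ∑ u, |A u z'| * K3 y z u) / c +
        (if Hk y x = 0 then (0 : ℝ) else C₃ / (ρ x z * ρ x t)) + (if Hk z x = 0 then (0 : ℝ) else C₃ / (ρ x y * ρ x t)) +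
        (if Hk t x = 0 then (0 : ℝ) else C₃ / (ρ x y * ρ x z)) + (if Hk z y = 0 then (0 : ℝ) else C₃ / (ρ x y * ρ x t)) +
        (if Hk t y = 0 then (0 : ℝ) else C₃ / (ρ x y * ρ x z)) + (if Hk t z = 0 then (0 : ℝ) else C₃ / (ρ x z * ρ x y)) +
        C₄ *
       ((r x y ^ 2)⁻¹ * (r x z ^ 2)⁻¹ * (r x t ^ 2)⁻¹ + (r x y ^ 2)⁻¹ * (r y z ^ 2)⁻¹ * (r y t ^ 2)⁻¹ + (r x z ^ 2)⁻¹ * (r y z ^ 2)⁻¹ * (r z t ^ 2)⁻¹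
           + (r x t ^ 2)⁻¹ * (r y t ^ 2)⁻¹ * (r z t ^ 2)⁻¹ + (r x y ^ 2)⁻¹ * (r y z ^ 2)⁻¹ * (r z t ^ 2)⁻¹ + (r x y ^ 2)⁻¹ * (r y t ^ 2)⁻¹ * (r z t ^
           2)⁻¹ + (r x z ^ 2)⁻¹ * (r y z ^ 2)⁻¹ * (r y t ^ 2)⁻¹ + (r x z ^ 2)⁻¹ * (r y t ^ 2)⁻¹ * (r z t ^ 2)⁻¹ + (r x t ^ 2)⁻¹ * (r y z ^ 2)⁻¹ * (r
           y t ^ 2)⁻¹ + (r x t ^ 2)⁻¹ * (r y z ^ 2)⁻¹ * (r z t ^ 2)⁻¹ + (r x y ^ 2)⁻¹ * (r x z ^ 2)⁻¹ * (r z t ^ 2)⁻¹ + (r x y ^ 2)⁻¹ * (r x t ^ 2)⁻¹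
           * (r z t ^ 2)⁻¹ + (r x y ^ 2)⁻¹ * (r x z ^ 2)⁻¹ * (r y t ^ 2)⁻¹ + (r x z ^ 2)⁻¹ * (r x t ^ 2)⁻¹ * (r y t ^ 2)⁻¹ + (r x y ^ 2)⁻¹ * (r x t ^
           2)⁻¹ * (r y z ^ 2)⁻¹ + (r x z ^ 2)⁻¹ * (r x t ^ 2)⁻¹ * (r y z ^ 2)⁻¹)) ≤
      k4s3 + (2 * (αr * k4s3 * (αc * hc)) + hr * αr * (αc * k4c) + αr * k4s3 * (αc * hc) + 3 * (αr * k3m * (αc * k3c))) * dr * dc / c +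
        6 * ((n : ℝ) * (C₃ * S ^ 2)) + C₄ * (16 * S' ^ 3) := by
  haveI : Nonempty ι := ⟨t⟩
  obtain ⟨w₀⟩ := ‹Nonempty κ›
  have hbv0 : 0 ≤ αc * hc := (Finset.sum_nonneg fun v _ => whitened_obs_nonneg hHk0 A v w₀).trans (whitened_obs_colsum_le hHk0 hαc hhc w₀)
  have hkv0 : 0 ≤ αc * k4c := (Finset.sum_nonneg fun y _ => Finset.sum_nonneg fun z _ => Finset.sum_nonneg fun t _ =>
    third_vector_nonneg hK40 A y z t w₀).trans (third_vector_colsum_le hK40 hαc hk4c w₀)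
  have hgv0 : 0 ≤ αc * k3c := (Finset.sum_nonneg fun y _ => Finset.sum_nonneg fun z _ => hess_vector_nonneg hK30 A y z w₀).trans
    (hessian_obs_colsum hK30 hαc hk3c w₀)
  have h1 := (sum3_cycle' _).symm.trans_le (hk4s3 t)
  have h2 := master21 hD hDr hDc hcpos (a := (fun x z w => ∑ u, |A u w| * K4 x z t u)) (b := (fun y w => ∑ u, |A u w| * Hk y u)) (fun _ _ z =>
      third_vector_nonneg hK40 A _ _ _ z) (fun _ z => whitened_obs_nonneg hHk0 A _ z) (third_vector_mass_three hK40 hαr hk4s3 t) (fun w =>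
      whitened_obs_colsum_le hHk0 hαc hhc w) hbv0
  beta_reduce at h2
  replace h2 := (sum3_swap23 _).symm.trans_le h2
  have h3 := master21 hD hDr hDc hcpos (a := (fun x y w => ∑ u, |A u w| * K4 x y t u)) (b := (fun z w => ∑ u, |A u w| * Hk z u)) (fun _ _ z =>
      third_vector_nonneg hK40 A _ _ _ z) (fun _ z => whitened_obs_nonneg hHk0 A _ z) (third_vector_mass_three hK40 hαr hk4s3 t) (fun w =>
      whitened_obs_colsum_le hHk0 hαc hhc w) hbv0
  beta_reduce at h3
  have h4 := master03_rev hD hDr hDc hcpos (a := (fun w => ∑ u, |A u w| * Hk t u)) (b := (fun x y z w => ∑ u, |A u w| * K4 x y z u)) (fun z =>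
      whitened_obs_nonneg hHk0 A _ z) (fun _ _ _ z => third_vector_nonneg hK40 A _ _ _ z) (whitened_obs_rowsum_le hHk0 hαr hhr t) (fun w =>
      third_vector_colsum_le hK40 hαc hk4c w) hkv0
  beta_reduce at h4
  have h5 := master21_rev hD hDr hDc hcpos (a := (fun y z w => ∑ u, |A u w| * K4 y z t u)) (b := (fun x w => ∑ u, |A u w| * Hk x u)) (fun _ _ z =>
      third_vector_nonneg hK40 A _ _ _ z) (fun _ z => whitened_obs_nonneg hHk0 A _ z) (third_vector_mass_three hK40 hαr hk4s3 t) (fun w =>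
      whitened_obs_colsum_le hHk0 hαc hhc w) hbv0
  beta_reduce at h5
  have h6 := master12_rev hD hDr hDc hcpos (a := (fun z w => ∑ u, |A u w| * K3 z t u)) (b := (fun x y w => ∑ u, |A u w| * K3 x y u)) (fun _ z =>
      hess_vector_nonneg hK30 A _ _ z) (fun _ _ z => hess_vector_nonneg hK30 A _ _ z) (hessian_obs_mass_second hK30 hαr hk3m t) (fun w =>
      hessian_obs_colsum hK30 hαc hk3c w) hgv0
  beta_reduce at h6
  have h7 := master12_rev hD hDr hDc hcpos (a := (fun y w => ∑ u, |A u w| * K3 y t u)) (b := (fun x z w => ∑ u, |A u w| * K3 x z u)) (fun _ z =>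
      hess_vector_nonneg hK30 A _ _ z) (fun _ _ z => hess_vector_nonneg hK30 A _ _ z) (hessian_obs_mass_second hK30 hαr hk3m t) (fun w =>
      hessian_obs_colsum hK30 hαc hk3c w) hgv0
  beta_reduce at h7
  replace h7 := (sum3_swap23 _).symm.trans_le h7
  have h8 := master12 hD hDr hDc hcpos (a := (fun x w => ∑ u, |A u w| * K3 x t u)) (b := (fun y z w => ∑ u, |A u w| * K3 y z u)) (fun _ z =>
      hess_vector_nonneg hK30 A _ _ z) (fun _ _ z => hess_vector_nonneg hK30 A _ _ z) (hessian_obs_mass_second hK30 hαr hk3m t) (fun w =>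
      hessian_obs_colsum hK30 hαc hk3c w) hgv0
  beta_reduce at h8
  have h9 := star_root_k hC3 hρ1 hρsymm hS hn t
  have h10 := (sum3_swap23 _).symm.trans_le (star_root_k hC3 hρ1 hρsymm hS hn t)
  have h11 := star_root_i hC3 hρ1 hS hn' t
  have h12 := path_root_c hC3 hρ1 hρsymm hS hn t
  have h13 := (sum3_swap12 _).symm.trans_le (path_root_a hC3 hρ1 hρsymm hS hn' t)
  have h14 := (sum3_cycle _).symm.trans_le (path_root_a hC3 hρ1 hρsymm hS hn' t)
  have h15 := const_mul_sum3_le hC4 (tree16_sum_slot_four hrsymm hSr t)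
  beta_reduce at h1 h2 h3 h4 h5 h6 h7 h8 h9 h10 h11 h12 h13 h14
  have hsum := add_le_add (add_le_add (add_le_add (add_le_add (add_le_add (add_le_add (add_le_add (add_le_add (add_le_add (add_le_add (add_le_add
    (add_le_add (add_le_add (add_le_add h1 h2) h3) h4) h5) h6) h7) h8) h9) h10) h11) h12) h13) h14) h15
  exact (sum3_add15 _ _ _ _ _ _ _ _ _ _ _ _ _ _ _).trans_le (hsum.trans (le_of_eq (by ring)))

end TheEnds

/-! ## §3. Toy -/

/-- Toy ((528) §1's constant step on `Fin 1`): `Σ 2·1 ≤ 2·1`. -/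
example : ∑ _a : Fin 1, ∑ _b : Fin 1, ∑ _c : Fin 1, (2 : ℝ) * 1 ≤ 2 * 1 :=
  const_mul_sum3_le (ι := Fin 1) (f := fun _ _ _ => (1 : ℝ)) (by norm_num) (by simp)

end Summit.QuantumFields.BalabanUV.T4Continuum.NE7b.SupFourthKernelEntryLettersTwo

end
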